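import Literature.Barriers.SmoothPoincare4.ExoticOpenFourSpaceOrbitManifoldProofs
import Literature.Geometry.Riemannian.RiemannianMetricExists
import Literature.Geometry.Lorentzian.IsometryProofs
import Literature.Geometry.Manifold.BilinSectionGluing
import Mathlib.Geometry.Manifold.VectorBundle.ContMDiffSection
import HarnessLib

/-!
# `deMichelisFreedman1992_continuum`: the end-periodic metrics `M_n`, `M_∞` (§0, §2 (1)–(2), p. 247)

Proof file (a structure packaging the data, three definitions, theorems; sibling of
`ExoticOpenFourSpaceOrbitManifoldProofs`) in the cone of the named fact
`Literature.Barriers.SmoothPoincare4.deMichelisFreedman1992_continuum` (DeMichelis–Freedman 1992,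
Thm. 4.1 with Cor. 4.1).

The tree renders the end that a diffeomorphism `(R⁴_s, K) ≅ (R⁴_t, K)`, `s < t`, produces (the
self-map `σ = incl ∘ d⁻¹` of `X = R⁴_t`, the rings `R⁴_k ∖ R⁴_{k+1}`, Taubes' height function —
`ExoticOpenFourSpaceEndPeriodicProofs`), its orbit space `Y` as a compact Hausdorff space
(`ExoticOpenFourSpaceOrbitSpaceProofs`) and `Y`'s smooth structure
(`ExoticOpenFourSpaceOrbitManifoldProofs`). The source continues (§0, p. 220): "Giving `Y` some
Riemannian metric, it is easy to alter the Riemannian metric on `B` and `Q` so that `n`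
consecutive rings `R⁴_t ∖ dⁿ(R⁴_t)` cover `Y` isometrically. Call the results `B_n` and `Q_n`. In
the limits as `n → ∞` we reach noncompact end periodic manifolds `B_∞` and `Q_∞` which are
simply Riemannian structures on `B ∖ inc(⋂ dⁱ(R⁴_t))` and `Q ∖ …`"; §2 (p. 223) makes this
precise: "Give `Y` a fixed Riemannian metric. Let `M_n`, `n = 1, 2, 3, …`, be a sequence of
Riemannian metrics on `M` so that: (1) in the induced metric, the projection
`R⁴_n ∖ R⁴_{n+1} → Y` is a local isometry and (2) the identity `M_n → M_m` is an isometry in the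
complement of `R⁴_{min(n+1,m+1)}`. Let `M_∞` be the unique metric on `M ∖ ⋂ R⁴_n` so that the
inclusions `M_∞ ↪ M_n` are isometries on the complement of `R⁴_{n+1}`"; and the proof of
Thm. 4.1 (p. 247): "this allows the construction of end periodic metrics, so that Theorem 2.1
applies". THIS FILE constructs these metrics on the part of `M` where anything happens, the open
set `R⁴ = U` (the metrics equal the given ambient metric `g₀` off a compact subset of `U`, so
they extend by the metric of `M`), with the tree's Riemannian-geometry vocabulary
(`Literature.Geometry.Lorentzian.PseudoRiemannianMetric`, `IsRiemannian`, `pullbackBilin`,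
`comap`, `IsLocalIsometry`; existence of a metric on `Y` by
`Literature.Geometry.Riemannian.exists_isRiemannian`).

Contents:
* `EndPeriodicData` — the data of §2 (open `V ⊆ U ⊆ E`, a diffeomorphism `φ : V ≅ U`, so that
  `σ = incl ∘ φ⁻¹`, and a compact `C ⊇ σ(U)`); `EndPeriodicData.End` — the end
  `U ∖ ⋂ₖ σ^[k](U)` as an OPEN SUBMANIFOLD of `U` (its points are those of `EndCompl σ`);
  instances: `Y = OrbitSpace σ` is a compact Hausdorff `C^∞` manifold (from the sibling files);
* `contMDiff_orbitProj`, `isLocalDiffeomorph_orbitProj` — the projection `End → Y` is a `C^∞`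
  local diffeomorphism (identity in the charts `orbitChart`);
* `coverMetric`, `isLocalIsometry_orbitProj` — the pulled-back metric `π^* g_Y` on the end, for
  which the projection is a local isometry ("cover `Y` isometrically");
* `EndPeriodic.glueMetric` — gluing two Riemannian metrics by a smooth bump (convex combination;
  Mathlib's `ContMDiffOn.smul_section_of_tsupport`);
* `exists_endPeriodicMetrics` — **the metrics `M_n` (`g n`, `n ≥ 0`) and `M_∞` (`gInf`)**:
  `g n = g₀` off a compact `C'`; (1) `g n = π^* g_Y` on the rings `1, …, n`; (2) `g m = g n` off
  `R⁴_{n+1}` (`n ≤ m`); `gInf = g n` off `R⁴_{n+1}`, `gInf = π^* g_Y` on `R⁴_1 ∖ ⋂ₖ R⁴_k`;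
* `deck`, `pullbackBilin_deck_coverMetric`, `isIsometricImmersion_deck`,
  `pullbackBilin_deck_eq_of_eqOn`, `eq_of_forall_eq_off_range_iterate` — the deck transformation
  `σ` of the end is an isometry of `π^* g_Y` (`π ∘ σ = π`: Taubes' periodicity), hence of `M_∞`
  on `R⁴_1 ∖ ⋂ₖ R⁴_k`; `M_∞` is unique;
* `polarEndPeriodicData`, `exists_endPeriodicMetrics_of_diffeomorph` — the same for the polar
  family of the tree's reduction (`d : R⁴_s ≅ R⁴_t`, `s < t`, `s < 1`).

Indexing and scope. The tree's `R⁴_k = range (σ^[k])`, `k ≥ 0`, is the source's `R⁴_{k+1}`;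
the isometric rings start at ring `1` because on ring `0 = U ∖ σ(U)`, which reaches the
frontier of `U` in `M`, the ambient metric and `π^* g_Y` must be interpolated (the source's
`M = M_0` is `M` with the metric altered there, §0 "alter the Riemannian metric on `B` and
`Q`"). NOT formalized: the gauge theory these metrics feed (Thm. 2.1, App. A–B: `Φ` commutes with
the geometric limit `M_n → M_∞`; `Φ(B) ≠ Φ(Q)`). No named fact is introduced (D-0026).

## References

* S. DeMichelis, M. H. Freedman, *Uncountably many exotic `R⁴`'s in standard 4-space*,
  J. Differential Geom. 35 (1992) 219–254: §0 (p. 220), §2 (pp. 222–223, conditions (1), (2),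
  `M_∞`), proof of Thm. 4.1 (p. 247) [DeMichelisFreedman1992].
* C. H. Taubes, *Gauge theory on asymptotically periodic 4-manifolds*, J. Differential Geom. 25
  (1987) 363–430, Def. 1.2–1.3 (end-periodic manifolds and metrics) [Taubes1987].
* J. M. Lee, *Introduction to Smooth Manifolds*, 2nd ed. (2012), Prop. 13.3 (gluing metrics by
  partitions of unity) [Lee2012].

[DeMichelisFreedman1992]
-/

noncomputable section

open scoped Manifold ContDiff Topology
open TopologicalSpace Set Function Filter Topology Bundle

namespace Literature.Barriers.SmoothPoincare4

namespace EndPeriodic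

/-! #### The end as an open subset; the projection -/

section General

variable {X : Type*} [TopologicalSpace X] {σ : X → X} {C : Set X}

/-- The complement of the end compactum as an OPEN SUBSET of `X` (so that, for `X` a manifold,
it is an open submanifold); as a type it is `EndCompl σ`. [folklore] -/
abbrev endOpens (σ : X → X) (hopen : IsOpen (⋂ k, range (σ^[k]))ᶜ) : Opens X :=
  ⟨(⋂ k, range (σ^[k]))ᶜ, hopen⟩

/-- The type of points of `endOpens σ _` is `EndCompl σ` (definitionally). [folklore] -/
theorem coe_sort_endOpens (σ : X → X) (hopen : IsOpen (⋂ k, range (σ^[k]))ᶜ) :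
    (endOpens σ hopen : Type _) = EndCompl σ := rfl

/-- The projection of the end onto the orbit space `Y` ("the projection `R⁴_n ∖ R⁴_{n+1} → Y`",
§2 (1)). [cite: DeMichelisFreedman1992, §2 (p. 223)] -/
abbrev orbitProj (σ : X → X) : EndCompl σ → OrbitSpace σ := Quotient.mk (orbitSetoid σ)

end General

/-! #### Gluing two Riemannian metrics by a bump function -/

section Glue

open Literature.Geometry.Lorentzian

variable {E : Type*} [NormedAddCommGroup E] [NormedSpace ℝ E] {H : Type*} [TopologicalSpace H]
  {I : ModelWithCorners ℝ E H} {M : Type*} [TopologicalSpace M] [ChartedSpace H M]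
  [IsManifold I ∞ M]

/-- A convex combination `a p + (1 - a) q` of a positive `q` and a `p` which is positive whenever
its coefficient is, is positive ("only positivity needs to be checked", Lee 2012, proof of
Prop. 13.3). [folklore] -/
theorem pos_of_convex_comb {a p q : ℝ} (ha0 : 0 ≤ a) (ha1 : a ≤ 1) (hp : 0 < a → 0 < p)
    (hq : 0 < q) : 0 < a * p + (1 - a) * q := by
  rcases eq_or_lt_of_le ha0 with rfl | ha
  · simpa using hq
  · exact add_pos_of_pos_of_nonneg (mul_pos ha (hp ha)) (mul_nonneg (sub_nonneg.2 ha1) hq.le)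

/-- **Gluing metrics by a bump function** (the device of "alter the Riemannian metric", §0;
Lee 2012, Prop. 13.3 pattern): for a `C^∞` function `a : M → [0, 1]` whose topological support
lies in an open set `O`, a symmetric field `s` of bilinear forms which is `C^∞` on `O` and
positive definite wherever `a > 0`, and a `C^∞` symmetric positive definite field `t`, the field
`a s + (1 - a) t` is a `C^∞` Riemannian metric (`C^∞` by Mathlib's
`ContMDiffOn.smul_section_of_tsupport`; positive as a convex combination).
[cite: DeMichelisFreedman1992, §0 (p. 220)] -/
def glueMetric (a : M → ℝ) (s t : Π x : M, TangentSpace I x →L[ℝ] TangentSpace I x →L[ℝ] ℝ)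
    {O : Set M} (hO : IsOpen O) (ha : ContMDiff I 𝓘(ℝ) ∞ a) (hsupp : tsupport a ⊆ O)
    (ha01 : ∀ x, a x ∈ Icc (0 : ℝ) 1)
    (hs : ContMDiffOn I (I.prod 𝓘(ℝ, E →L[ℝ] E →L[ℝ] ℝ)) ∞
      (fun x : M => TotalSpace.mk' (E →L[ℝ] E →L[ℝ] ℝ)
        (E := fun x : M => TangentSpace I x →L[ℝ] TangentSpace I x →L[ℝ] ℝ) x (s x)) O)
    (ht : ContMDiff I (I.prod 𝓘(ℝ, E →L[ℝ] E →L[ℝ] ℝ)) ∞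
      (fun x : M => TotalSpace.mk' (E →L[ℝ] E →L[ℝ] ℝ)
        (E := fun x : M => TangentSpace I x →L[ℝ] TangentSpace I x →L[ℝ] ℝ) x (t x)))
    (hsymm_s : ∀ x v w, s x v w = s x w v) (hsymm_t : ∀ x v w, t x v w = t x w v)
    (hpos_s : ∀ x, 0 < a x → ∀ v, v ≠ 0 → 0 < s x v v) (hpos_t : ∀ x v, v ≠ 0 → 0 < t x v v) :
    PseudoRiemannianMetric I ∞ E (TangentSpace I : M → Type _) where
  val x := a x • s x + (1 - a x) • t x
  symm x v w := by
    simp only [add_apply, smul_apply, hsymm_s x v w, hsymm_t x v w]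
  nondegenerate x v hv := by
    by_contra hne
    have h : 0 < (a x • s x + (1 - a x) • t x) v v := by
      simp only [add_apply, smul_apply, smul_eq_mul]
      exact pos_of_convex_comb (ha01 x).1 (ha01 x).2 (fun hax => hpos_s x hax v hne)
        (hpos_t x v hne)
    exact h.ne' (hv v)
  contMDiff :=
    (ContMDiffOn.smul_section_of_tsupport ha.contMDiffOn hO hsupp hs).add_section
      ((contMDiff_const.sub ha).smul_section ht)

/-- The glued metric at `x` is `a x • s x + (1 - a x) • t x`. [folklore] -/
theorem glueMetric_val_apply (a : M → ℝ)
    (s t : Π x : M, TangentSpace I x →L[ℝ] TangentSpace I x →L[ℝ] ℝ)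
    {O : Set M} (hO : IsOpen O) (ha : ContMDiff I 𝓘(ℝ) ∞ a) (hsupp : tsupport a ⊆ O)
    (ha01 : ∀ x, a x ∈ Icc (0 : ℝ) 1)
    (hs : ContMDiffOn I (I.prod 𝓘(ℝ, E →L[ℝ] E →L[ℝ] ℝ)) ∞
      (fun x : M => TotalSpace.mk' (E →L[ℝ] E →L[ℝ] ℝ)
        (E := fun x : M => TangentSpace I x →L[ℝ] TangentSpace I x →L[ℝ] ℝ) x (s x)) O)
    (ht : ContMDiff I (I.prod 𝓘(ℝ, E →L[ℝ] E →L[ℝ] ℝ)) ∞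
      (fun x : M => TotalSpace.mk' (E →L[ℝ] E →L[ℝ] ℝ)
        (E := fun x : M => TangentSpace I x →L[ℝ] TangentSpace I x →L[ℝ] ℝ) x (t x)))
    (hsymm_s : ∀ x v w, s x v w = s x w v) (hsymm_t : ∀ x v w, t x v w = t x w v)
    (hpos_s : ∀ x, 0 < a x → ∀ v, v ≠ 0 → 0 < s x v v) (hpos_t : ∀ x v, v ≠ 0 → 0 < t x v v)
    (x : M) :
    (glueMetric a s t hO ha hsupp ha01 hs ht hsymm_s hsymm_t hpos_s hpos_t).val x =
      a x • s x + (1 - a x) • t x :=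
  rfl

/-- **The glued metric is Riemannian.** [folklore] -/
theorem isRiemannian_glueMetric (a : M → ℝ)
    (s t : Π x : M, TangentSpace I x →L[ℝ] TangentSpace I x →L[ℝ] ℝ)
    {O : Set M} (hO : IsOpen O) (ha : ContMDiff I 𝓘(ℝ) ∞ a) (hsupp : tsupport a ⊆ O)
    (ha01 : ∀ x, a x ∈ Icc (0 : ℝ) 1)
    (hs : ContMDiffOn I (I.prod 𝓘(ℝ, E →L[ℝ] E →L[ℝ] ℝ)) ∞
      (fun x : M => TotalSpace.mk' (E →L[ℝ] E →L[ℝ] ℝ)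
        (E := fun x : M => TangentSpace I x →L[ℝ] TangentSpace I x →L[ℝ] ℝ) x (s x)) O)
    (ht : ContMDiff I (I.prod 𝓘(ℝ, E →L[ℝ] E →L[ℝ] ℝ)) ∞
      (fun x : M => TotalSpace.mk' (E →L[ℝ] E →L[ℝ] ℝ)
        (E := fun x : M => TangentSpace I x →L[ℝ] TangentSpace I x →L[ℝ] ℝ) x (t x)))
    (hsymm_s : ∀ x v w, s x v w = s x w v) (hsymm_t : ∀ x v w, t x v w = t x w v)
    (hpos_s : ∀ x, 0 < a x → ∀ v, v ≠ 0 → 0 < s x v v) (hpos_t : ∀ x v, v ≠ 0 → 0 < t x v v) :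
    (glueMetric a s t hO ha hsupp ha01 hs ht hsymm_s hsymm_t hpos_s hpos_t).IsRiemannian := by
  intro x v hv
  rw [glueMetric_val_apply]
  simp only [add_apply, smul_apply, smul_eq_mul]
  exact pos_of_convex_comb (ha01 x).1 (ha01 x).2 (fun hax => hpos_s x hax v hv) (hpos_t x v hv)

end Glue

end EndPeriodic

/-! ### The data of an end-periodic end inside an open subset of a vector space -/

/-- **The data producing an end-periodic end** (§2, p. 223: "`R⁴` an open subset …, an open
submanifold `R'⁴` contained in a compact submanifold of `R⁴`, `R'⁴ ⊂ C ⊂ R⁴`, and a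
diffeomorphism `d : R⁴ → R'⁴`"): open subsets `V ⊆ U` of `E`, a diffeomorphism `φ : V ≅ U`
(so `σ = incl ∘ φ⁻¹ : U → U` is a diffeomorphism of `U` onto `V`, the source's `d`), and a
compact `C ⊆ U` containing `σ(U) = V`. In the tree `U = R⁴_t`, `V = R⁴_s`, `φ = d`
(`polarEndPeriodicData`). [cite: DeMichelisFreedman1992, §2 (p. 223)] -/
structure EndPeriodicData (E : Type*) [NormedAddCommGroup E] [NormedSpace ℝ E] where
  /-- The open subset `R⁴` of `E`. -/
  U : Opens E
  /-- The open subset `R'⁴ ⊆ R⁴`. -/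
  V : Opens E
  /-- `R'⁴ ⊆ R⁴`. -/
  hVU : V ≤ U
  /-- The diffeomorphism `R'⁴ ≅ R⁴` (inverse of the source's `d`). -/
  φ : V ≃ₘ⟮𝓘(ℝ, E), 𝓘(ℝ, E)⟯ U
  /-- The compact set `C` with `R'⁴ ⊆ C ⊆ R⁴`. -/
  C : Set U
  /-- `C` is compact. -/
  hC : IsCompact C
  /-- `σ(R⁴) = R'⁴ ⊆ C`. -/
  hσC : range (Opens.inclusion hVU ∘ φ.symm) ⊆ C

namespace EndPeriodicData

open EndPeriodic

variable {E : Type*} [NormedAddCommGroup E] [NormedSpace ℝ E] (D : EndPeriodicData E)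

/-- The self-embedding `σ = incl ∘ φ⁻¹ : U → U` (the source's `d : R⁴ → R'⁴ ⊂ R⁴`).
[cite: DeMichelisFreedman1992, §2 (p. 223)] -/
def σ : D.U → D.U := Opens.inclusion D.hVU ∘ D.φ.symm

/-- Unfolding `σ`. [folklore] -/
theorem σ_def : D.σ = Opens.inclusion D.hVU ∘ D.φ.symm := rfl

/-- `σ` is an open embedding. [cite: DeMichelisFreedman1992, §2 (pp. 222–223)] -/
theorem isOpenEmbedding_σ : IsOpenEmbedding D.σ :=
  EndPeriodic.isOpenEmbedding_inclusion_comp_symm_opens D.hVU D.φ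

/-- `σ(U) ⊆ C`. [cite: DeMichelisFreedman1992, §2 (p. 223)] -/
theorem range_σ_subset : range D.σ ⊆ D.C := D.hσC

/-- The complement of the end compactum `⋂ₖ σ^[k](U)` is open in `U`. [folklore] -/
theorem isOpen_compl_iInter : IsOpen (⋂ k, range (D.σ^[k]))ᶜ :=
  (isClosed_iInter_range_iterate D.isOpenEmbedding_σ.continuous D.hC D.hσC).isOpen_compl

/-- **The end `U ∖ ⋂ₖ σ^[k](U)` as an open submanifold of `U`** (hence of `E`); its points are
those of `EndCompl σ`. [cite: DeMichelisFreedman1992, §0 (p. 220), §2 (p. 223)] -/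
abbrev End : Opens D.U := endOpens D.σ D.isOpen_compl_iInter

/-- Extended charts of an open submanifold of an open subset of `E` are the double coercion.
[folklore] -/
theorem extChartAt_opens_opens_apply {U : Opens E} (W : Opens U) (y z : W) :
    extChartAt 𝓘(ℝ, E) y z = ((z : U) : E) := rfl

omit [NormedSpace ℝ E] in
/-- Every point of an open submanifold of an open subset of `E` lies in the source of every
preferred chart (all preferred charts are the double coercion). [folklore] -/
theorem mem_chartAt_source_opens_opens {U : Opens E} (W : Opens U) (y z : W) :
    z ∈ (chartAt E y).source := by
  change z ∈ (chartAt E z).source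
  exact mem_chart_source E z

/-- An open subset of a locally compact (Hausdorff) space is locally compact. [folklore] -/
instance instLocallyCompactSpaceU [LocallyCompactSpace E] : LocallyCompactSpace D.U :=
  D.U.2.locallyCompactSpace

section LocallyCompact

variable [LocallyCompactSpace E]

/-- The orbit space `Y` of the end, with its atlas `orbitChartedSpace` (local inverses of the
projection followed by the coordinate embedding). [cite: DeMichelisFreedman1992, §0 (p. 220), §2 (p. 223)] -/
instance instChartedSpaceOrbitSpace : ChartedSpace E (OrbitSpace D.σ) :=
  orbitChartedSpace D.isOpenEmbedding_σ D.hC D.hσC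

/-- `Y` is a `C^∞` manifold (`isManifold_orbitSpace`). [cite: DeMichelisFreedman1992, §0 (p. 220), §2 (p. 223)] -/
instance instIsManifoldOrbitSpace : IsManifold 𝓘(ℝ, E) ∞ (OrbitSpace D.σ) :=
  isManifold_orbitSpace D.hVU D.φ D.hC D.hσC

/-- `Y` is compact (`compactSpace_orbitSpace`). [cite: DeMichelisFreedman1992, §2 (p. 223)] -/
instance instCompactSpaceOrbitSpace : CompactSpace (OrbitSpace D.σ) :=
  compactSpace_orbitSpace D.isOpenEmbedding_σ D.hC D.hσC

/-- `Y` is Hausdorff (`t2Space_orbitSpace`). [cite: DeMichelisFreedman1992, §2 (p. 223)] -/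
instance instT2SpaceOrbitSpace : T2Space (OrbitSpace D.σ) :=
  t2Space_orbitSpace D.isOpenEmbedding_σ D.hC D.hσC

/-! #### The projection to the orbit space is a `C^∞` local diffeomorphism -/

/-- **The projection of the end onto the orbit space is `C^∞`** (for the open-submanifold
structure on the end and the atlas `orbitChartedSpace` on `Y`): in the chart of `Y` at the image
of `y` built from the window of `y` itself, the projection reads as the identity on coordinates
(`orbitChart_mk`). [cite: DeMichelisFreedman1992, §0 (p. 220), §2 (p. 223)] -/
theorem contMDiff_orbitProj : ContMDiff 𝓘(ℝ, E) 𝓘(ℝ, E) ∞ (fun y : D.End => orbitProj D.σ y) := by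
  intro y
  refine (contMDiffAt_iff_of_mem_maximalAtlas (e := chartAt E y)
    (e' := orbitChart D.isOpenEmbedding_σ D.hC D.hσC y) (f := fun y : D.End => orbitProj D.σ y)
    (IsManifold.chart_mem_maximalAtlas y) (IsManifold.subset_maximalAtlas (mem_range_self y))
    (mem_chart_source E y)
    (mk_mem_orbitChart_source D.isOpenEmbedding_σ D.hC D.hσC (mem_window_self _ y))).2
    ⟨continuous_mk.continuousAt, ?_⟩
  simp only [modelWithCornersSelf_coe, range_id]
  apply ContDiffAt.contDiffWithinAt
  change ContDiffAt ℝ ∞ ((orbitChart D.isOpenEmbedding_σ D.hC D.hσC y).extend 𝓘(ℝ, E) ∘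
    (fun y : D.End => orbitProj D.σ y) ∘ (extChartAt 𝓘(ℝ, E) y).symm) (extChartAt 𝓘(ℝ, E) y y)
  refine contDiffAt_id.congr_of_eventuallyEq ?_
  -- near the coordinates of `y`, the inverse chart lands in the window of `y`
  have hwin : (extChartAt 𝓘(ℝ, E) y).symm ⁻¹'
      window (heightFun D.isOpenEmbedding_σ D.hC D.hσC) y ∈ 𝓝 (extChartAt 𝓘(ℝ, E) y y) := by
    refine (continuousAt_extChartAt_symm y).preimage_mem_nhds ?_
    rw [extChartAt_to_inv]
    exact (isOpen_window (continuous_heightFun_coe D.isOpenEmbedding_σ D.hC D.hσC) y).mem_nhds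
      (mem_window_self _ y)
  filter_upwards [extChartAt_target_mem_nhds (I := 𝓘(ℝ, E)) y, hwin] with p hp hpw
  rw [Function.comp_apply, Function.comp_apply, OpenPartialHomeomorph.extend_coe,
    Function.comp_apply, modelWithCornersSelf_coe, id, orbitChart_mk _ _ _ hpw]
  rw [← extChartAt_opens_opens_apply D.End y]
  exact (extChartAt 𝓘(ℝ, E) y).right_inv hp

/-- The local inverse of the projection on the window of `y` (`mkWindow` for the chosen height
function), an open partial homeomorphism from the end to `Y`. [folklore] -/
abbrev projWindow (y : EndCompl D.σ) : OpenPartialHomeomorph (EndCompl D.σ) (OrbitSpace D.σ) :=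
  mkWindow D.isOpenEmbedding_σ D.isOpen_compl_iInter
    (continuous_heightFun_coe D.isOpenEmbedding_σ D.hC D.hσC)
    (heightFun_iterate D.isOpenEmbedding_σ D.hC D.hσC) y

/-- **The local inverse of the projection on a window is `C^∞`**: in the charts `orbitChart y`
of `Y` and the open-submanifold chart of the end it reads as the identity. [folklore] -/
theorem contMDiffOn_projWindow_symm (y : EndCompl D.σ) :
    ContMDiffOn 𝓘(ℝ, E) 𝓘(ℝ, E) (M' := D.End) ∞ (D.projWindow y).symm
      (orbitProj D.σ '' window (heightFun D.isOpenEmbedding_σ D.hC D.hσC) y) := by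
  rw [contMDiffOn_iff_of_mem_maximalAtlas' (e := orbitChart D.isOpenEmbedding_σ D.hC D.hσC y)
    (e' := chartAt E (show D.End from y)) (IsManifold.subset_maximalAtlas (mem_range_self y))
    (IsManifold.chart_mem_maximalAtlas _) (by rw [orbitChart_source])
    (fun q _ => mem_chartAt_source_opens_opens _ _ _)]
  refine contDiffOn_id.congr fun p hp => ?_
  -- `p` is the coordinate vector of a point `z` of the window of `y`
  obtain ⟨q, ⟨z, hz, rfl⟩, rfl⟩ := hp
  have hleft : (D.projWindow y).symm (orbitProj D.σ z) = z :=
    (D.projWindow y).left_inv (by rw [mkWindow_source]; exact hz)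
  have hchart : ∀ w : D.End, chartAt E (show D.End from y) w = ((w : D.U) : E) := fun w => rfl
  simp only [OpenPartialHomeomorph.extend_coe, OpenPartialHomeomorph.extend_coe_symm,
    modelWithCornersSelf_coe, modelWithCornersSelf_coe_symm, Function.comp_apply, id_eq, hchart,
    orbitChart_mk _ _ _ hz]
  rw [orbitChart_symm_apply_coe, hleft]

/-- The local inverse of the projection on the window of `y`, as a partial diffeomorphism.
[folklore] -/
def projWindowDiffeomorph (y : EndCompl D.σ) :
    PartialDiffeomorph 𝓘(ℝ, E) 𝓘(ℝ, E) D.End (OrbitSpace D.σ) ∞ where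
  toPartialEquiv := (D.projWindow y).toPartialEquiv
  open_source := (D.projWindow y).open_source
  open_target := (D.projWindow y).open_target
  contMDiffOn_toFun := D.contMDiff_orbitProj.contMDiffOn
  contMDiffOn_invFun := D.contMDiffOn_projWindow_symm y

/-- **The projection of the end onto the orbit space is a `C^∞` local diffeomorphism** (its
restriction to each window is a diffeomorphism onto an open subset of `Y`).
[cite: DeMichelisFreedman1992, §0 (p. 220), §2 (p. 223)] -/
theorem isLocalDiffeomorph_orbitProj :
    IsLocalDiffeomorph 𝓘(ℝ, E) 𝓘(ℝ, E) ∞ (fun y : D.End => orbitProj D.σ y) := fun y =>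
  ⟨D.projWindowDiffeomorph y, mem_window_self _ y, fun _ _ => rfl⟩

/-- The differential of the projection is injective at every point of the end. [folklore] -/
theorem injective_mfderiv_orbitProj (y : D.End) :
    Injective (mfderiv 𝓘(ℝ, E) 𝓘(ℝ, E) (fun y : D.End => orbitProj D.σ y) y) :=
  ((D.isLocalDiffeomorph_orbitProj y).mfderivToContinuousLinearEquiv (by simp)).injective

/-! #### The pulled-back metric: the end covers `Y` by a local isometry -/

/-- A `C^∞` map is `C^{∞ + 1}` (`∞ + 1 = ∞`). [folklore] -/
theorem contMDiff_orbitProj_add_one :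
    ContMDiff 𝓘(ℝ, E) 𝓘(ℝ, E) (∞ + 1) (fun y : D.End => orbitProj D.σ y) :=
  D.contMDiff_orbitProj.of_le (le_of_eq (by rfl))

end LocallyCompact

section CoverMetric

open Literature.Geometry.Lorentzian Literature.Geometry.Lorentzian.PseudoRiemannianMetric

variable [FiniteDimensional ℝ E]

/-- **The pulled-back metric `π^* g_Y` on the end** ("in the induced metric, the projection
`R⁴_n ∖ R⁴_{n+1} → Y` is a local isometry", §2 (1)): the pullback of a `C^∞` metric `g_Y` of
the orbit space along the projection (`PseudoRiemannianMetric.comap`; smooth by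
`contMDiff_pullbackBilin_holds`, nondegenerate because the differential of the projection is
a linear isomorphism). [cite: DeMichelisFreedman1992, §0 (p. 220), §2 (p. 223)] -/
def coverMetric (gY : PseudoRiemannianMetric 𝓘(ℝ, E) ∞ E (TangentSpace 𝓘(ℝ, E) : OrbitSpace D.σ → Type _)) :
    PseudoRiemannianMetric 𝓘(ℝ, E) ∞ E (TangentSpace 𝓘(ℝ, E) : D.End → Type _) :=
  gY.comap contMDiff_pullbackBilin_holds (fun y : D.End => orbitProj D.σ y)
    D.contMDiff_orbitProj_add_one D.injective_mfderiv_orbitProj rfl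

/-- The pulled-back metric at `y` is `(π^* g_Y)_y`. [folklore] -/
@[simp] theorem coverMetric_val
    (gY : PseudoRiemannianMetric 𝓘(ℝ, E) ∞ E (TangentSpace 𝓘(ℝ, E) : OrbitSpace D.σ → Type _))
    (y : D.End) :
    (D.coverMetric gY).val y =
      pullbackBilin (I := 𝓘(ℝ, E)) (I' := 𝓘(ℝ, E)) (fun y : D.End => orbitProj D.σ y) gY.val y :=
  rfl

/-- The pulled-back metric of a Riemannian metric is Riemannian. [folklore] -/
theorem isRiemannian_coverMetric
    {gY : PseudoRiemannianMetric 𝓘(ℝ, E) ∞ E (TangentSpace 𝓘(ℝ, E) : OrbitSpace D.σ → Type _)}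
    (hgY : gY.IsRiemannian) : (D.coverMetric gY).IsRiemannian := by
  intro y v hv
  rw [coverMetric_val, pullbackBilin_apply]
  refine hgY _ _ fun h0 => hv (D.injective_mfderiv_orbitProj y ?_)
  rw [map_zero]
  exact h0

/-- **The end, with the pulled-back metric, covers `Y` by a local isometry** ("`n` consecutive
rings cover `Y` isometrically", §0; §2 (1)). [cite: DeMichelisFreedman1992, §0 (p. 220), §2 (p. 223)] -/
theorem isLocalIsometry_orbitProj
    (gY : PseudoRiemannianMetric 𝓘(ℝ, E) ∞ E (TangentSpace 𝓘(ℝ, E) : OrbitSpace D.σ → Type _)) :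
    IsLocalIsometry (D.coverMetric gY) gY (fun y : D.End => orbitProj D.σ y) :=
  ⟨D.isLocalDiffeomorph_orbitProj, fun _ => rfl⟩

end CoverMetric

/-! #### The metrics `M_n` and `M_∞` (restricted to `R⁴ = U`) -/

section Metrics

open Literature.Geometry.Lorentzian Literature.Geometry.Lorentzian.PseudoRiemannianMetric
  Literature.Geometry.Manifold

variable [FiniteDimensional ℝ E]

/-- The orbit space carries a `C^∞` Riemannian metric ("Give `Y` a fixed Riemannian metric",
§2; "Giving `Y` some Riemannian metric", §0): it is a compact Hausdorff `C^∞` manifold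
(`exists_isRiemannian`, Lee 2012, Prop. 13.3). [cite: DeMichelisFreedman1992, §0 (p. 220), §2 (p. 223)] -/
theorem exists_isRiemannian_orbitSpace :
    ∃ gY : PseudoRiemannianMetric 𝓘(ℝ, E) ∞ E (TangentSpace 𝓘(ℝ, E) : OrbitSpace D.σ → Type _),
      gY.IsRiemannian :=
  Literature.Geometry.Riemannian.exists_isRiemannian

/-- **End-periodic metrics (DeMichelis–Freedman 1992, §0 and §2 (1)–(2)), on `R⁴ = U`.** Let
`g₀` be a `C^∞` Riemannian metric on `U` (the restriction of the metric of the ambient `M`, `B`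
or `Q`) and `g_Y` a `C^∞` Riemannian metric on the orbit space `Y`. Write
`R⁴_k = σ^[k](U)` (`k ≥ 0`; the source's `R⁴_{k+1}`), ring `k` for `R⁴_k ∖ R⁴_{k+1}`, and
`π^* g_Y` for the pulled-back metric on the end `U ∖ ⋂ₖ R⁴_k` (`coverMetric`; the projection is
a local isometry for it, `isLocalIsometry_orbitProj`). Then there are `C^∞` Riemannian metrics
`g n` on `U` (`n ≥ 0`) and `gInf` on the end, and a compact `C' ⊆ U`, such that
* `g n = g₀` off `C'` (so `g n` extends by the ambient metric: "alter the Riemannian metric on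
  `B` and `Q`", §0 — these are the `M_n` restricted to `U`);
* (1) on the rings `1, …, n` the metric `g n` is `π^* g_Y` ("`n` consecutive rings cover `Y`
  isometrically", §0; "(1) in the induced metric, the projection `R⁴_n ∖ R⁴_{n+1} → Y` is a
  local isometry", §2);
* (2) `g m = g n` off `R⁴_{n+1}` for `n ≤ m` ("(2) the identity `M_n → M_m` is an isometry in
  the complement of `R⁴_{min(n+1,m+1)}`", §2);
* `gInf = g n` off `R⁴_{n+1}` for every `n` ("`M_∞` the unique metric on `M ∖ ⋂ R⁴_n` so that the
  inclusions `M_∞ ↪ M_n` are isometries on the complement of `R⁴_{n+1}`", §2), and `gInf = π^* g_Y`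
  on `R⁴_1 ∖ ⋂ₖ R⁴_k` (the periodic end: "noncompact end periodic manifolds `B_∞` and `Q_∞`", §0;
  "this allows the construction of end periodic metrics", p. 247).
Construction: `g n = (χ ψₙ) π^* g_Y + (1 - χ ψₙ) g₀`, `gInf = χ π^* g_Y + (1 - χ) g₀` for smooth bumps
`χ = 1` near `C ⊇ R⁴_1`, `χ = 0` off a compact `C'`, and `ψₙ = 1` near `U ∖ R⁴_{n+1}`, `ψₙ = 0`
near `σ^[n+1](C) ⊇ R⁴_{n+2}` (convex combinations of inner products are inner products).
Scope: ring `0` (which reaches the frontier of `U` in `M`) is where `g₀` and `π^* g_Y` are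
interpolated, so the isometric rings start at `1` (the source's indexing `R⁴ = R⁴_1` is the
tree's `R⁴_0 = U`); the gauge theory for which these metrics are built (Thm. 2.1) is not
formalized. [cite: DeMichelisFreedman1992, §0 (p. 220), §2 (p. 223), proof of Thm. 4.1 (p. 247)] -/
theorem exists_endPeriodicMetrics
    (g₀ : PseudoRiemannianMetric 𝓘(ℝ, E) ∞ E (TangentSpace 𝓘(ℝ, E) : D.U → Type _))
    (hg₀ : g₀.IsRiemannian)
    (gY : PseudoRiemannianMetric 𝓘(ℝ, E) ∞ E (TangentSpace 𝓘(ℝ, E) : OrbitSpace D.σ → Type _))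
    (hgY : gY.IsRiemannian) :
    ∃ (C' : Set D.U) (g : ℕ → PseudoRiemannianMetric 𝓘(ℝ, E) ∞ E (TangentSpace 𝓘(ℝ, E) : D.U → Type _))
      (gInf : PseudoRiemannianMetric 𝓘(ℝ, E) ∞ E (TangentSpace 𝓘(ℝ, E) : D.End → Type _)),
      IsCompact C' ∧ (∀ n, (g n).IsRiemannian) ∧ gInf.IsRiemannian ∧
      (∀ n (x : D.U), x ∉ C' → (g n).val x = g₀.val x) ∧
      (∀ n k, 1 ≤ k → k ≤ n → ∀ y : D.End,
        (y : D.U) ∈ range (D.σ^[k]) \ range (D.σ^[k + 1]) →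
          ((g n).val (y : D.U) : E →L[ℝ] E →L[ℝ] ℝ) = (D.coverMetric gY).val y) ∧
      (∀ n m (x : D.U), n ≤ m → x ∉ range (D.σ^[n + 1]) → (g m).val x = (g n).val x) ∧
      (∀ n (y : D.End), (y : D.U) ∉ range (D.σ^[n + 1]) →
        (gInf.val y : E →L[ℝ] E →L[ℝ] ℝ) = (g n).val (y : D.U)) ∧
      (∀ y : D.End, (y : D.U) ∈ range D.σ → gInf.val y = (D.coverMetric gY).val y) := by
  classical
  -- notation
  set Kinf : Set D.U := ⋂ k, range (D.σ^[k]) with hKinf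
  have hKc : IsCompact Kinf := isCompact_iInter_range_iterate D.isOpenEmbedding_σ.continuous D.hC D.hσC
  have hanti : Antitone fun k => range (D.σ^[k]) := antitone_range_iterate D.σ
  have hKsub : ∀ k, Kinf ⊆ range (D.σ^[k]) := fun k => iInter_subset _ k
  set cov := D.coverMetric gY with hcov
  have hcovR : cov.IsRiemannian := D.isRiemannian_coverMetric hgY
  -- the compact `C'` and the outer bump `χ`
  obtain ⟨C', hC', hCC'⟩ := exists_compact_superset D.hC
  obtain ⟨χ, hχ0, hχ1, hχ01⟩ := exists_contMDiffMap_zero_one_nhds_of_isClosed (I := 𝓘(ℝ, E))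
    (M := D.U) (n := ⊤) isOpen_interior.isClosed_compl D.hC.isClosed
    (disjoint_compl_left_iff_subset.2 hCC')
  -- the inner bumps `ψ n`
  have hψex : ∀ n : ℕ, ∃ ψ : C^∞⟮𝓘(ℝ, E), D.U; 𝓘(ℝ), ℝ⟯,
      (∀ᶠ x in 𝓝ˢ (D.σ^[n + 1] '' D.C), ψ x = 0) ∧
      (∀ᶠ x in 𝓝ˢ (range (D.σ^[n + 1]))ᶜ, ψ x = 1) ∧ ∀ x, ψ x ∈ Icc (0 : ℝ) 1 := fun n =>
    exists_contMDiffMap_zero_one_nhds_of_isClosed (I := 𝓘(ℝ, E)) (M := D.U) (n := ⊤)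
      (D.hC.image (D.isOpenEmbedding_σ.continuous.iterate _)).isClosed
      ((isOpenEmbedding_iterate D.isOpenEmbedding_σ (n + 1)).isOpen_range.isClosed_compl)
      (disjoint_compl_right_iff_subset.2 (image_subset_range _ _))
  choose ψ hψ0 hψ1 hψ01 using hψex
  -- `π^* g_Y` extended by `0` over the end compactum
  set ĝ : Π x : D.U, TangentSpace 𝓘(ℝ, E) x →L[ℝ] TangentSpace 𝓘(ℝ, E) x →L[ℝ] ℝ :=
    fun x => if h : x ∈ Kinfᶜ then cov.val ⟨x, h⟩ else 0 with hĝ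
  have hĝ_end : ∀ y : D.End, ĝ y = cov.val y := fun y => dif_pos y.2
  have hĝ_symm : ∀ x v w, ĝ x v w = ĝ x w v := by
    intro x v w
    by_cases hx : x ∈ Kinfᶜ
    · rw [show ĝ x = cov.val ⟨x, hx⟩ from dif_pos hx]
      exact cov.symm _ v w
    · rw [show ĝ x = 0 from dif_neg hx]
      rfl
  have hĝ_smooth : ContMDiffOn 𝓘(ℝ, E) (𝓘(ℝ, E).prod 𝓘(ℝ, E →L[ℝ] E →L[ℝ] ℝ)) ∞
      (fun x : D.U => TotalSpace.mk' (E →L[ℝ] E →L[ℝ] ℝ)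
        (E := fun x : D.U => TangentSpace 𝓘(ℝ, E) x →L[ℝ] TangentSpace 𝓘(ℝ, E) x →L[ℝ] ℝ)
        x (ĝ x)) Kinfᶜ := by
    intro x hx
    have h := OpenSubmanifold.contMDiffAt_bilinSection_of_restrict (I := 𝓘(ℝ, E)) (n := ∞)
      (s := ĝ) D.End ⟨x, hx⟩ ?_
    · exact h.contMDiffWithinAt
    · have heq : (fun y : D.End => TotalSpace.mk' (E →L[ℝ] E →L[ℝ] ℝ)
          (E := fun y : D.End => TangentSpace 𝓘(ℝ, E) y →L[ℝ] TangentSpace 𝓘(ℝ, E) y →L[ℝ] ℝ)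
          y (ĝ y.1)) = fun y : D.End => TotalSpace.mk' (E →L[ℝ] E →L[ℝ] ℝ)
          (E := fun y : D.End => TangentSpace 𝓘(ℝ, E) y →L[ℝ] TangentSpace 𝓘(ℝ, E) y →L[ℝ] ℝ)
          y (cov.val y) := by
        funext y
        rw [hĝ_end y]
      rw [heq]
      exact cov.contMDiff _
  -- the coefficients `a n = χ ψ n`
  set a : ℕ → D.U → ℝ := fun n x => χ x * ψ n x with ha
  have ha_smooth : ∀ n, ContMDiff 𝓘(ℝ, E) 𝓘(ℝ) ∞ (a n) := fun n => χ.contMDiff.mul (ψ n).contMDiff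
  have ha01 : ∀ n x, a n x ∈ Icc (0 : ℝ) 1 := fun n x =>
    ⟨mul_nonneg (hχ01 x).1 (hψ01 n x).1, mul_le_one₀ (hχ01 x).2 (hψ01 n x).1 (hψ01 n x).2⟩
  have ha_tsupport : ∀ n, tsupport (a n) ⊆ Kinfᶜ := by
    intro n x hx
    rw [mem_compl_iff]
    intro hxK
    have hxC : x ∈ D.σ^[n + 1] '' D.C :=
      range_iterate_succ_subset_image D.hσC (n + 1) (hKsub (n + 1 + 1) hxK)
    have h0 : ∀ᶠ y in 𝓝 x, ψ n y = 0 := (eventually_nhdsSet_iff_forall.1 (hψ0 n)) x hxC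
    have h0' : a n =ᶠ[𝓝 x] 0 := h0.mono fun y hy => by simp [ha, hy]
    exact (notMem_tsupport_iff_eventuallyEq.2 h0') hx
  have hĝ_pos : ∀ n (x : D.U), 0 < a n x → ∀ v : TangentSpace 𝓘(ℝ, E) x, v ≠ 0 → 0 < ĝ x v v := by
    intro n x hax v hv
    have hxK : x ∈ Kinfᶜ := ha_tsupport n (subset_tsupport _ (Function.mem_support.2 hax.ne'))
    rw [show ĝ x = cov.val ⟨x, hxK⟩ from dif_pos hxK]
    exact hcovR ⟨x, hxK⟩ v hv
  -- the metrics `g n = (a n) ĝ + (1 - a n) g₀` on `U`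
  let g : ℕ → PseudoRiemannianMetric 𝓘(ℝ, E) ∞ E (TangentSpace 𝓘(ℝ, E) : D.U → Type _) := fun n =>
    glueMetric (a n) ĝ g₀.val D.isOpen_compl_iInter (ha_smooth n) (ha_tsupport n) (ha01 n)
      hĝ_smooth g₀.contMDiff hĝ_symm g₀.symm (hĝ_pos n) hg₀
  have hg_val : ∀ n x, (g n).val x = a n x • ĝ x + (1 - a n x) • g₀.val x := fun n x => rfl
  -- the metric `gInf = χ π^* g_Y + (1 - χ) g₀` on the end
  have hχE : ContMDiff 𝓘(ℝ, E) 𝓘(ℝ) ∞ fun y : D.End => χ (y : D.U) :=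
    χ.contMDiff.comp contMDiff_subtype_val
  set t₀ : Π y : D.End, TangentSpace 𝓘(ℝ, E) y →L[ℝ] TangentSpace 𝓘(ℝ, E) y →L[ℝ] ℝ :=
    fun y => g₀.val (y : D.U) with ht₀
  let gI : PseudoRiemannianMetric 𝓘(ℝ, E) ∞ E (TangentSpace 𝓘(ℝ, E) : D.End → Type _) :=
    glueMetric (fun y : D.End => χ (y : D.U)) cov.val t₀ isOpen_univ hχE (subset_univ _)
      (fun y => hχ01 _) (cov.contMDiff.contMDiffOn)
      (OpenSubmanifold.contMDiff_bilinSection (I := 𝓘(ℝ, E)) g₀.contMDiff D.End) cov.symm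
      (fun y v w => g₀.symm _ v w) (fun y _ v hv => hcovR y v hv) (fun y v hv => hg₀ _ v hv)
  have hgI_val : ∀ y : D.End, gI.val y = χ (y : D.U) • cov.val y + (1 - χ (y : D.U)) • t₀ y :=
    fun y => rfl
  -- values of the bumps
  have hχC' : ∀ x : D.U, x ∉ C' → χ x = 0 := fun x hx =>
    hχ0.self_of_nhdsSet x fun h => hx (interior_subset h)
  have hχC : ∀ x : D.U, x ∈ range D.σ → χ x = 1 := fun x hx => hχ1.self_of_nhdsSet x (D.hσC hx)
  have hψ_one : ∀ n (x : D.U), x ∉ range (D.σ^[n + 1]) → ψ n x = 1 := fun n x hx =>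
    (hψ1 n).self_of_nhdsSet x hx
  refine ⟨C', g, gI, hC', fun n => isRiemannian_glueMetric _ _ _ _ _ _ _ _ _ _ _ _ _,
    isRiemannian_glueMetric _ _ _ _ _ _ _ _ _ _ _ _ _, ?_, ?_, ?_, ?_, ?_⟩
  · -- `g n = g₀` off `C'`
    intro n x hx
    have h0 : a n x = 0 := by simp [ha, hχC' x hx]
    rw [hg_val, h0]
    ext v w
    simp only [add_apply, smul_apply, smul_eq_mul]
    ring
  · -- (1) rings `1, …, n` are isometric to `Y`
    rintro n k h1k hkn y ⟨hyk, hyk1⟩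
    have hχy : χ (y : D.U) = 1 := by
      refine hχC _ ?_
      have := hanti h1k hyk
      simpa only [Function.iterate_one] using this
    have hψy : ψ n (y : D.U) = 1 :=
      hψ_one n _ fun h => hyk1 (hanti (Nat.succ_le_succ hkn) h)
    have h1 : a n (y : D.U) = 1 := by simp [ha, hχy, hψy]
    rw [hg_val, h1, ← hĝ_end y]
    ext v w
    simp only [add_apply, smul_apply, smul_eq_mul]
    ring
  · -- (2) `g m = g n` off `R⁴_{n+1}`
    intro n m x hnm hx
    rw [hg_val, hg_val]
    have hm : ψ m x = 1 := hψ_one m x fun h => hx (hanti (Nat.succ_le_succ hnm) h)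
    simp only [ha, hψ_one n x hx, hm]
  · -- `gInf = g n` off `R⁴_{n+1}`
    intro n y hy
    rw [hg_val, hgI_val]
    simp only [ha, hψ_one n _ hy, mul_one]
    rw [hĝ_end y]
    rfl
  · -- `gInf = π^* g_Y` on `R⁴_1 ∖ ⋂ₖ R⁴_k`
    intro y hy
    rw [hgI_val, hχC _ hy]
    ext v w
    simp only [add_apply, smul_apply, smul_eq_mul]
    ring

end Metrics

/-! #### The deck transformation `σ` of the periodic end is an isometry of `π^* g_Y` (Taubes' periodicity) -/

section Deck

open Literature.Geometry.Lorentzian Literature.Geometry.Lorentzian.PseudoRiemannianMetric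

/-- **The deck transformation of the end**: `σ` maps the end `U ∖ ⋂ₖ σ^[k](U)` into itself
(the end compactum is `σ`-invariant, `apply_mem_iInter_range_iterate_iff`) — the generator of
the "covering action by the monoid `{d, d², d³, …}`" (§0). [cite: DeMichelisFreedman1992, §0 (p. 220)] -/
def deck : D.End → D.End := fun y =>
  ⟨D.σ y, fun h => y.2 ((apply_mem_iInter_range_iterate_iff D.isOpenEmbedding_σ.injective).1 h)⟩

/-- The deck transformation is `σ` on points. [folklore] -/
@[simp] theorem coe_deck (y : D.End) : ((D.deck y : D.End) : D.U) = D.σ y := rfl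

/-- The deck transformation commutes with the projection to the orbit space: `π ∘ σ = π`.
[cite: DeMichelisFreedman1992, §0 (p. 220)] -/
theorem orbitProj_deck (y : D.End) : orbitProj D.σ (D.deck y) = orbitProj D.σ y :=
  (mk_eq_mk_iff D.isOpenEmbedding_σ.injective).2 (Or.inl ⟨1, rfl⟩)

/-- `σ` is `C^∞` (for the open-submanifold structures). [cite: DeMichelisFreedman1992, §2 (pp. 222–223)] -/
theorem contMDiff_σ : ContMDiff 𝓘(ℝ, E) 𝓘(ℝ, E) ∞ D.σ :=
  (contMDiff_inclusion D.hVU).comp D.φ.symm.contMDiff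

/-- The deck transformation of the end is `C^∞`. [folklore] -/
theorem contMDiff_deck : ContMDiff 𝓘(ℝ, E) 𝓘(ℝ, E) ∞ D.deck := by
  intro y
  rw [← ContMDiffAt.subtypeVal_comp_iff]
  show ContMDiffAt 𝓘(ℝ, E) 𝓘(ℝ, E) ∞ (fun y : D.End => D.σ y) y
  exact contMDiffAt_subtype_iff.2 (D.contMDiff_σ _)

variable [FiniteDimensional ℝ E]

/-- **The deck transformation is an isometry of the pulled-back metric**: `σ^* (π^* g_Y) = π^* g_Y`
on the end (`π ∘ σ = π` and the chain rule for pullbacks) — the periodicity of an end-periodic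
metric in Taubes' formulation (the metric on the end is invariant under the deck transformation
of the cyclic cover). [cite: DeMichelisFreedman1992, §0 (p. 220), §2 (p. 223)] -/
theorem pullbackBilin_deck_coverMetric
    (gY : PseudoRiemannianMetric 𝓘(ℝ, E) ∞ E (TangentSpace 𝓘(ℝ, E) : OrbitSpace D.σ → Type _))
    (y : D.End) :
    pullbackBilin (I := 𝓘(ℝ, E)) (I' := 𝓘(ℝ, E)) D.deck (D.coverMetric gY).val y =
      (D.coverMetric gY).val y := by
  have hcomp : (fun y : D.End => orbitProj D.σ y) ∘ D.deck = fun y : D.End => orbitProj D.σ y :=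
    funext D.orbitProj_deck
  have hval : (D.coverMetric gY).val =
      pullbackBilin (I := 𝓘(ℝ, E)) (I' := 𝓘(ℝ, E)) (fun y : D.End => orbitProj D.σ y) gY.val :=
    rfl
  rw [hval, ← pullbackBilin_comp (D.contMDiff_orbitProj.mdifferentiable (by simp))
    (D.contMDiff_deck.mdifferentiable (by simp)), hcomp]

/-- The deck transformation is an isometric immersion of `(End, π^* g_Y)` into itself (indeed a
diffeomorphism onto the open subset `σ(End)`). [cite: DeMichelisFreedman1992, §0 (p. 220), §2 (p. 223)] -/
theorem isIsometricImmersion_deck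
    (gY : PseudoRiemannianMetric 𝓘(ℝ, E) ∞ E (TangentSpace 𝓘(ℝ, E) : OrbitSpace D.σ → Type _)) :
    IsIsometricImmersion (D.coverMetric gY) (D.coverMetric gY) D.deck :=
  ⟨D.contMDiff_deck, D.pullbackBilin_deck_coverMetric gY⟩

/-- **`M_∞` is end-periodic**: a metric `gInf` on the end which agrees with `π^* g_Y` on
`R⁴_1 ∖ ⋂ₖ R⁴_k` (as the `gInf` of `exists_endPeriodicMetrics` does) is invariant under the deck
transformation there: `(σ^* gInf)_y = (gInf)_y` for `y ∈ R⁴_1`. [cite: DeMichelisFreedman1992, §0 (p. 220), §2 (p. 223)] -/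
theorem pullbackBilin_deck_eq_of_eqOn
    (gY : PseudoRiemannianMetric 𝓘(ℝ, E) ∞ E (TangentSpace 𝓘(ℝ, E) : OrbitSpace D.σ → Type _))
    (gInf : PseudoRiemannianMetric 𝓘(ℝ, E) ∞ E (TangentSpace 𝓘(ℝ, E) : D.End → Type _))
    (h : ∀ y : D.End, (y : D.U) ∈ range D.σ → gInf.val y = (D.coverMetric gY).val y)
    (y : D.End) (hy : (y : D.U) ∈ range D.σ) :
    pullbackBilin (I := 𝓘(ℝ, E)) (I' := 𝓘(ℝ, E)) D.deck gInf.val y = gInf.val y := by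
  ext v w
  rw [pullbackBilin_apply, h (D.deck y) ⟨(y : D.U), rfl⟩, h y hy, ← pullbackBilin_apply,
    D.pullbackBilin_deck_coverMetric gY y]

omit [FiniteDimensional ℝ E] in
/-- **`M_∞` is unique** ("the unique metric on `M ∖ ⋂ R⁴_n` so that the inclusions
`M_∞ ↪ M_n` are isometries on the complement of `R⁴_{n+1}`", §2): two metrics on the end which
agree with `g n` off `R⁴_{n+1}` for every `n` coincide (every point of the end lies off some
`R⁴_{n+1}`). [cite: DeMichelisFreedman1992, §2 (p. 223)] -/
theorem eq_of_forall_eq_off_range_iterate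
    {g : ℕ → PseudoRiemannianMetric 𝓘(ℝ, E) ∞ E (TangentSpace 𝓘(ℝ, E) : D.U → Type _)}
    {gInf gInf' : PseudoRiemannianMetric 𝓘(ℝ, E) ∞ E (TangentSpace 𝓘(ℝ, E) : D.End → Type _)}
    (h : ∀ n (y : D.End), (y : D.U) ∉ range (D.σ^[n + 1]) →
      (gInf.val y : E →L[ℝ] E →L[ℝ] ℝ) = (g n).val (y : D.U))
    (h' : ∀ n (y : D.End), (y : D.U) ∉ range (D.σ^[n + 1]) →
      (gInf'.val y : E →L[ℝ] E →L[ℝ] ℝ) = (g n).val (y : D.U)) :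
    gInf = gInf' := by
  refine PseudoRiemannianMetric.ext (funext fun y => ?_)
  have hy2 : (y : D.U) ∉ ⋂ k, range (D.σ^[k]) := y.2
  have hy : ∃ n, (y : D.U) ∉ range (D.σ^[n]) := by
    simpa only [mem_iInter, not_forall] using hy2
  obtain ⟨n, hn⟩ := hy
  have hn1 : (y : D.U) ∉ range (D.σ^[n + 1]) := fun h1 =>
    hn (antitone_range_iterate D.σ (Nat.le_succ n) h1)
  exact (h n y hn1).trans (h' n y hn1).symm

end Deck

end EndPeriodicData

/-! ### The polar family of the tree's reduction -/

section Polar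

open EndPeriodic Literature.Geometry.Lorentzian Literature.Geometry.Lorentzian.PseudoRiemannianMetric

variable {E : Type*} [NormedAddCommGroup E] [NormedSpace ℝ E] [FiniteDimensional ℝ E]
  {R : Opens E} {e : R ≃ₜ E} {s t : ℝ}

/-- **The end-periodic data of the polar family**: for a diffeomorphism `d : R⁴_s ≅ R⁴_t`,
`s < t`, `s < 1` (the negation of the tree's no-go produces one,
`ExoticOpenFourSpacePolarNhdProofs`), `U = R⁴_t`, `V = R⁴_s`, `φ = d`, `σ = incl ∘ d⁻¹` and `C`
the closed polar ball `{(1 - s) ‖e ·‖ ≤ 1}` (compact, `isCompact_preimage_val_setOf_mul_norm_le`;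
contains `R⁴_s`, `range_inclusion_comp_symm_subset`).
[cite: DeMichelisFreedman1992, §0 (p. 220), §2 (p. 223), proof of Thm. 4.1 (p. 247)] -/
def polarEndPeriodicData (hst : s < t) (hs1 : s < 1)
    (d : polarBall R e s ≃ₘ⟮𝓘(ℝ, E), 𝓘(ℝ, E)⟯ polarBall R e t) : EndPeriodicData E where
  U := polarBall R e t
  V := polarBall R e s
  hVU := polarBall_mono R e hst.le
  φ := d
  C := (Subtype.val : polarBall R e t → E) ⁻¹' {x : E | ∃ hx : x ∈ R, (1 - s) * ‖e ⟨x, hx⟩‖ ≤ 1}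
  hC := isCompact_preimage_val_setOf_mul_norm_le R e hst hs1
  hσC := range_inclusion_comp_symm_subset hst.le d

/-- The self-embedding of the polar data is `σ = incl ∘ d⁻¹ : R⁴_t → R⁴_t`. [folklore] -/
@[simp] theorem polarEndPeriodicData_σ (hst : s < t) (hs1 : s < 1)
    (d : polarBall R e s ≃ₘ⟮𝓘(ℝ, E), 𝓘(ℝ, E)⟯ polarBall R e t) :
    (polarEndPeriodicData hst hs1 d).σ = Opens.inclusion (polarBall_mono R e hst.le) ∘ d.symm :=
  rfl

/-- The open set of the polar data is `R⁴_t`. [folklore] -/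
@[simp] theorem polarEndPeriodicData_U (hst : s < t) (hs1 : s < 1)
    (d : polarBall R e s ≃ₘ⟮𝓘(ℝ, E), 𝓘(ℝ, E)⟯ polarBall R e t) :
    (polarEndPeriodicData hst hs1 d).U = polarBall R e t :=
  rfl

/-- **End-periodic metrics for the polar family** (§0 with §2 (1)–(2), for the end that a
diffeomorphism `d : R⁴_s ≅ R⁴_t`, `s < t`, `s < 1`, produces — the metrics `B_n`, `Q_n`, `B_∞`,
`Q_∞` restricted to `R⁴_t`). For any Riemannian metric `g₀` on `R⁴_t` (the ambient metric of
`B` or `Q` restricted): the orbit space `Y` carries a Riemannian metric `g_Y` ("Giving `Y` some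
Riemannian metric"), the end `R⁴_t ∖ ⋂ₖ R⁴_k` with the pulled-back metric covers `Y` by a local
isometry, and there are Riemannian metrics `g n` on `R⁴_t` (`n ≥ 0`) equal to `g₀` off a compact
set, agreeing with the pulled-back metric on the rings `1, …, n` ("`n` consecutive rings cover
`Y` isometrically"), pairwise equal off `R⁴_{n+1}` (§2 (2)), together with their limit `gInf` on
the end (`M_∞`: equal to `g n` off `R⁴_{n+1}`, and to the pulled-back metric on `R⁴_1 ∖ ⋂ₖ R⁴_k`).
Here `D = polarEndPeriodicData hst hs1 d`, `D.U = R⁴_t`, `D.σ = incl ∘ d⁻¹`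
(`polarEndPeriodicData_U`, `polarEndPeriodicData_σ`), `R⁴_k = range (D.σ^[k])`. What the source
does with these metrics (Thm. 2.1: `Φ(B) = Φ(B_n) = Φ(B_∞)`) is gauge theory and is not
formalized. [cite: DeMichelisFreedman1992, §0 (p. 220), §2 (p. 223), proof of Thm. 4.1 (p. 247)] -/
theorem exists_endPeriodicMetrics_of_diffeomorph (hst : s < t) (hs1 : s < 1)
    (d : polarBall R e s ≃ₘ⟮𝓘(ℝ, E), 𝓘(ℝ, E)⟯ polarBall R e t)
    (g₀ : PseudoRiemannianMetric 𝓘(ℝ, E) ∞ E (TangentSpace 𝓘(ℝ, E) : polarBall R e t → Type _))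
    (hg₀ : g₀.IsRiemannian) :
    ∃ (gY : PseudoRiemannianMetric 𝓘(ℝ, E) ∞ E
        (TangentSpace 𝓘(ℝ, E) : OrbitSpace (polarEndPeriodicData hst hs1 d).σ → Type _))
      (C' : Set (polarEndPeriodicData hst hs1 d).U)
      (g : ℕ → PseudoRiemannianMetric 𝓘(ℝ, E) ∞ E
        (TangentSpace 𝓘(ℝ, E) : (polarEndPeriodicData hst hs1 d).U → Type _))
      (gInf : PseudoRiemannianMetric 𝓘(ℝ, E) ∞ E
        (TangentSpace 𝓘(ℝ, E) : (polarEndPeriodicData hst hs1 d).End → Type _)),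
      gY.IsRiemannian ∧
      IsLocalIsometry ((polarEndPeriodicData hst hs1 d).coverMetric gY) gY
        (fun y : (polarEndPeriodicData hst hs1 d).End =>
          orbitProj (polarEndPeriodicData hst hs1 d).σ y) ∧
      IsCompact C' ∧ (∀ n, (g n).IsRiemannian) ∧ gInf.IsRiemannian ∧
      (∀ n (x : (polarEndPeriodicData hst hs1 d).U), x ∉ C' → (g n).val x = g₀.val x) ∧
      (∀ n k, 1 ≤ k → k ≤ n → ∀ y : (polarEndPeriodicData hst hs1 d).End,
        (y : (polarEndPeriodicData hst hs1 d).U) ∈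
          range ((polarEndPeriodicData hst hs1 d).σ^[k]) \
            range ((polarEndPeriodicData hst hs1 d).σ^[k + 1]) →
          ((g n).val (y : (polarEndPeriodicData hst hs1 d).U) : E →L[ℝ] E →L[ℝ] ℝ) =
            ((polarEndPeriodicData hst hs1 d).coverMetric gY).val y) ∧
      (∀ n m (x : (polarEndPeriodicData hst hs1 d).U), n ≤ m →
        x ∉ range ((polarEndPeriodicData hst hs1 d).σ^[n + 1]) → (g m).val x = (g n).val x) ∧
      (∀ n (y : (polarEndPeriodicData hst hs1 d).End),
        (y : (polarEndPeriodicData hst hs1 d).U) ∉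
          range ((polarEndPeriodicData hst hs1 d).σ^[n + 1]) →
          (gInf.val y : E →L[ℝ] E →L[ℝ] ℝ) = (g n).val (y : (polarEndPeriodicData hst hs1 d).U)) ∧
      (∀ y : (polarEndPeriodicData hst hs1 d).End,
        (y : (polarEndPeriodicData hst hs1 d).U) ∈ range (polarEndPeriodicData hst hs1 d).σ →
          gInf.val y = ((polarEndPeriodicData hst hs1 d).coverMetric gY).val y) := by
  obtain ⟨gY, hgY⟩ := (polarEndPeriodicData hst hs1 d).exists_isRiemannian_orbitSpace
  obtain ⟨C', g, gInf, h⟩ :=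
    (polarEndPeriodicData hst hs1 d).exists_endPeriodicMetrics g₀ hg₀ gY hgY
  exact ⟨gY, C', g, gInf, hgY, (polarEndPeriodicData hst hs1 d).isLocalIsometry_orbitProj gY, h⟩

end Polar

end Literature.Barriers.SmoothPoincare4
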